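import Mathlib
import Summits.PneNP.PneNP.Theorems.ClusUniversalCertificateCoordColumns

/-!
# Route ClusUniversalCertificate — path `coord` on the crux `UniversalCertAll` (stmt-PneNP-19683): the TWO-BLOCK base
(rung F-N1, cell pnp-ideate, planner p1 g6/g7; registered skeleton HOME/pnp-ideate-p1/lines/layer.lean v11 sha16 e5cba65d;
stub `stub_baseTwoBlocks`, M, offered to this seat on STATUS 09:55Z/09:58Z/10:06Z)

The registered stub `stub_baseTwoBlocks` of p1's path `coord`, BY NAME, against the objects of
`ClusUniversalCertificateCoordDefs.lean` (p516754): the mixed-block universal certificate `UCMix M n blk Y` whenever at most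
TWO blocks are nonempty (every size allowed).  With `J` the set of nonempty blocks, `UCMix` reads
`Σ_{y∈Y} (n − codim_Y y) ≤ (n − |J|)·|Y| + Σ_{j∈J} 2^{b_j}·Z_j(Y)` (an empty block `j` has `Z_j(Y) = |Y|` and weight `2^0`).

PROOF (mixed-size version of line card §UC2 = `ClusLayer.stub_ucLeTwo`, p513574; helper lemmas in
`ClusUniversalCertificateCoordColumns.lean`).
* `Y = univ`: equality for every block map (`ClusCoordTwoBlocks.ucMix_univ`).
* `Y ≠ univ`: every point has `codim ≥ 1`, which settles `|J| ≤ 1`; for `J = {j₁, j₂}` the left side is at most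
  `(n − 2)|Y| + #{y : codim_Y y = 1}`, and COLUMN DOMINATION (`ClusCoordTwoBlocks.card_le_of_hyperplanes`) transported along the
  coordinate splitting `𝔽₂^M ≃ₗ 𝔽₂^{B₁} × 𝔽₂^{B₂}` (`card_acodimOne_le`) bounds the codimension-`1` points by
  `2^{b₂}·Z_{j₂}(Y) + 2^{b₁}·Z_{j₁}(Y)`.

HONEST FRAMING: ONE registered M-sized stub (a two-block counting theorem about affine flats) of an OPEN crux of route
ClusUniversalCertificate; the load-bearing stub `stub_peelZeroRare3` is OPEN and XL; FRONTIER rung F-N1 — nothing here bears on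
P vs NP.
-/

set_option linter.dupNamespace false -- `Summit.PneNP.PneNP.…`: summit = sub-problem name (D-0017 single-conjunct layout)

namespace Summit.PneNP.PneNP.Theorems.ClusCoordTwoBlocks

open Finset
open Summit.PneNP.PneNP.Theorems.ClusCoord (acodim bsize zcount UCMix)

variable {M n : ℕ}

/-- **Two nonempty blocks, `Y ≠ univ`**: the points of certificate codimension `1` number at most
`2^{b₂}·Z_{j₂}(Y) + 2^{b₁}·Z_{j₁}(Y)` (column domination transported along `𝔽₂^M ≃ₗ 𝔽₂^{B₁} × 𝔽₂^{B₂}`). -/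
theorem card_acodimOne_le (blk : Fin M → Fin n) (Y : Finset (Fin M → ZMod 2)) (hY : Y ≠ univ)
    {j₁ j₂ : Fin n} (hne : j₁ ≠ j₂) (hcover : ∀ i, blk i = j₁ ∨ blk i = j₂) :
    (Y.filter fun y => acodim M Y y = 1).card ≤
      2 ^ bsize blk j₂ * zcount blk j₂ Y + 2 ^ bsize blk j₁ * zcount blk j₁ Y := by
  classical
  -- the coordinate splitting as a linear equivalence
  obtain ⟨Φ, hΦ1, hΦ2⟩ : ∃ Φ : (Fin M → ZMod 2) ≃ₗ[ZMod 2]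
      (({i : Fin M // blk i = j₁} → ZMod 2) × ({i : Fin M // blk i = j₂} → ZMod 2)),
      (∀ y, ∀ i : {i : Fin M // blk i = j₁}, (Φ y).1 i = y i.1) ∧
      (∀ y, ∀ i : {i : Fin M // blk i = j₂}, (Φ y).2 i = y i.1) := by
    refine ⟨{ toFun := fun y => (fun i => y i.1, fun i => y i.1)
              invFun := fun p i => if h : blk i = j₁ then p.1 ⟨i, h⟩ else p.2 ⟨i, (hcover i).resolve_left h⟩
              left_inv := ?_
              right_inv := ?_
              map_add' := fun _ _ => rfl
              map_smul' := fun _ _ => rfl }, fun _ _ => rfl, fun _ _ => rfl⟩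
    · intro y
      funext i
      by_cases h : blk i = j₁
      · simp only [dif_pos h]
      · simp only [dif_neg h]
    · rintro ⟨p₁, p₂⟩
      simp only [Prod.mk.injEq]
      refine ⟨funext fun i => ?_, funext fun i => ?_⟩
      · simp only [dif_pos i.2]
      · have hi : ¬ blk i.1 = j₁ := fun h => hne (h.symm.trans i.2)
        simp only [dif_neg hi]
  set U := Y.filter fun y => acodim M Y y = 1 with hUdef
  set Y' := Y.image Φ with hY'def
  set U' := U.image Φ with hU'def
  -- every point of `U'` lies on an affine hyperplane inside `Y'`
  have hU' : ∀ u' ∈ U', ∃ f : (({i : Fin M // blk i = j₁} → ZMod 2) × ({i : Fin M // blk i = j₂} → ZMod 2)) →ₗ[ZMod 2]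
      ZMod 2, ∀ x, f x = f u' → x ∈ Y' := by
    intro u' hu'
    obtain ⟨u, hu, rfl⟩ := mem_image.mp hu'
    obtain ⟨huY, hu1⟩ := mem_filter.mp hu
    obtain ⟨f, hf⟩ := exists_functional_of_acodim_eq_one hY huY hu1
    refine ⟨f.comp Φ.symm.toLinearMap, fun x hx => ?_⟩
    rw [LinearMap.comp_apply, LinearMap.comp_apply] at hx
    have hx' : f (Φ.symm x) = f u := by simpa using hx
    exact mem_image.mpr ⟨Φ.symm x, hf _ hx', by simp⟩
  have hmain := card_le_of_hyperplanes Y' U' hU'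
  -- read the counts back on `𝔽₂^M`
  have hU : U.card = U'.card := (card_image_of_injective U Φ.injective).symm
  have hz1 : (Y'.filter fun p => p.1 = 0).card = zcount blk j₁ Y := by
    unfold zcount
    rw [hY'def, filter_image, card_image_of_injective _ Φ.injective]
    congr 1
    apply filter_congr
    intro y _
    constructor
    · intro h i hi
      have := congrFun h ⟨i, hi⟩
      rwa [hΦ1] at this
    · intro h
      funext i
      rw [hΦ1]
      exact h i.1 i.2
  have hz2 : (Y'.filter fun p => p.2 = 0).card = zcount blk j₂ Y := by
    unfold zcount
    rw [hY'def, filter_image, card_image_of_injective _ Φ.injective]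
    congr 1
    apply filter_congr
    intro y _
    constructor
    · intro h i hi
      have := congrFun h ⟨i, hi⟩
      rwa [hΦ2] at this
    · intro h
      funext i
      rw [hΦ2]
      exact h i.1 i.2
  rw [hU, ← hz1, ← hz2, ← card_blockFun blk j₁, ← card_blockFun blk j₂]
  exact hmain

end Summit.PneNP.PneNP.Theorems.ClusCoordTwoBlocks

namespace Summit.PneNP.PneNP.Theorems.ClusCoord

open Finset
open Summit.PneNP.PneNP.Theorems.ClusCoordZeroFree (zcount_of_bsize_eq_zero)
open Summit.PneNP.PneNP.Theorems.ClusCoordTwoBlocks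

/-- **Registered stub `stub_baseTwoBlocks`** of the path `coord` (stmt-PneNP-19683, skeleton v11), BY NAME: the mixed-block
universal certificate holds whenever at most two blocks are nonempty (every block size). -/
theorem stub_baseTwoBlocks : ∀ M n : ℕ, ∀ blk : Fin M → Fin n, ∀ Y : Finset (Fin M → ZMod 2),
    (univ.filter fun j : Fin n => 0 < bsize blk j).card ≤ 2 → UCMix M n blk Y := by
  intro M n blk Y hJ
  classical
  by_cases hY : Y = univ
  · subst hY; exact ucMix_univ blk
  set J := univ.filter fun j : Fin n => 0 < bsize blk j with hJdef
  have hJmem : ∀ j, j ∈ J ↔ 0 < bsize blk j := fun j => by simp [hJdef]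
  unfold UCMix
  -- the left side is `Σ_y (n − codim y)`
  have hsumb := sum_bsize_sub_one blk
  have hl : ∀ y, (((M : ℤ) - (acodim M Y y : ℤ)) - ∑ j : Fin n, ((bsize blk j : ℤ) - 1)) =
      (n : ℤ) - (acodim M Y y : ℤ) := by
    intro y; rw [hsumb]; ring
  simp_rw [hl]
  -- the right side: the empty blocks contribute `(n − |J|)·|Y|`
  have hempty : ∀ j ∈ univ.filter (fun j : Fin n => ¬ 0 < bsize blk j),
      (2 : ℤ) ^ bsize blk j * (zcount blk j Y : ℤ) = (Y.card : ℤ) := by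
    intro j hj
    have h0 : bsize blk j = 0 := by have := (mem_filter.mp hj).2; omega
    rw [h0, pow_zero, one_mul, zcount_of_bsize_eq_zero blk Y j h0]
  have hJc : ((univ.filter fun j : Fin n => ¬ 0 < bsize blk j).card : ℤ) = (n : ℤ) - (J.card : ℤ) := by
    have := card_filter_add_card_filter_not (s := (univ : Finset (Fin n))) (fun j => 0 < bsize blk j)
    rw [card_univ, Fintype.card_fin] at this
    rw [hJdef]
    omega
  have hRHS : ∑ j : Fin n, (2 : ℤ) ^ bsize blk j * (zcount blk j Y : ℤ) =
      ∑ j ∈ J, (2 : ℤ) ^ bsize blk j * (zcount blk j Y : ℤ) + ((n : ℤ) - (J.card : ℤ)) * (Y.card : ℤ) := by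
    rw [← sum_filter_add_sum_filter_not univ (fun j : Fin n => 0 < bsize blk j), sum_congr rfl hempty,
      sum_const, nsmul_eq_mul, hJc]
  rw [hRHS]
  have hnonneg : 0 ≤ ∑ j ∈ J, (2 : ℤ) ^ bsize blk j * (zcount blk j Y : ℤ) :=
    sum_nonneg fun j _ => by positivity
  -- every point has `codim ≥ 1`
  have h1 : ∀ y ∈ Y, 1 ≤ acodim M Y y := fun y hy => one_le_acodim hY hy
  by_cases hJ2 : J.card ≤ 1
  · -- at most one nonempty block: `n − codim ≤ n − 1 ≤ n − |J|`
    calc ∑ y ∈ Y, ((n : ℤ) - (acodim M Y y : ℤ)) ≤ ∑ _y ∈ Y, ((n : ℤ) - (J.card : ℤ)) :=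
          sum_le_sum fun y hy => by
            have := h1 y hy
            have hJ' : (J.card : ℤ) ≤ 1 := by exact_mod_cast hJ2
            have h1' : (1 : ℤ) ≤ (acodim M Y y : ℤ) := by exact_mod_cast this
            linarith
      _ = ((n : ℤ) - (J.card : ℤ)) * (Y.card : ℤ) := by rw [sum_const, nsmul_eq_mul, mul_comm]
      _ ≤ _ := by linarith
  · -- exactly two nonempty blocks `j₁ ≠ j₂`
    have hJ2' : J.card = 2 := by omega
    obtain ⟨j₁, j₂, hne, hJeq⟩ := card_eq_two.mp hJ2'
    have hcover : ∀ i, blk i = j₁ ∨ blk i = j₂ := by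
      intro i
      have hi : blk i ∈ J := by
        rw [hJmem]
        unfold bsize
        exact card_pos.mpr ⟨i, by simp⟩
      rw [hJeq, mem_insert, mem_singleton] at hi
      exact hi
    have hU := card_acodimOne_le blk Y hY hne hcover
    have hU' : (((Y.filter fun y => acodim M Y y = 1).card : ℕ) : ℤ) ≤
        (2 : ℤ) ^ bsize blk j₂ * (zcount blk j₂ Y : ℤ) + (2 : ℤ) ^ bsize blk j₁ * (zcount blk j₁ Y : ℤ) := by
      exact_mod_cast hU
    -- the left side is at most `(n − 2)|Y| + #{codim = 1}`
    have hlhs : ∑ y ∈ Y, ((n : ℤ) - (acodim M Y y : ℤ)) ≤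
        ∑ y ∈ Y, (((n : ℤ) - 2) + if acodim M Y y = 1 then 1 else 0) := by
      apply sum_le_sum
      intro y hy
      have := h1 y hy
      split_ifs with h
      · rw [h]; push_cast; linarith
      · have h2 : 2 ≤ acodim M Y y := by omega
        have h2' : (2 : ℤ) ≤ (acodim M Y y : ℤ) := by exact_mod_cast h2
        linarith
    have hcard1 : (((Y.filter fun y => acodim M Y y = 1).card : ℕ) : ℤ) =
        ∑ y ∈ Y, (if acodim M Y y = 1 then (1 : ℤ) else 0) := by
      rw [Finset.card_filter]
      push_cast
      rfl
    have hind : ∑ y ∈ Y, (((n : ℤ) - 2) + if acodim M Y y = 1 then 1 else 0) =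
        ((n : ℤ) - 2) * (Y.card : ℤ) + (((Y.filter fun y => acodim M Y y = 1).card : ℕ) : ℤ) := by
      rw [sum_add_distrib, sum_const, nsmul_eq_mul, mul_comm, hcard1]
    have hJsum : ∑ j ∈ J, (2 : ℤ) ^ bsize blk j * (zcount blk j Y : ℤ) =
        (2 : ℤ) ^ bsize blk j₁ * (zcount blk j₁ Y : ℤ) + (2 : ℤ) ^ bsize blk j₂ * (zcount blk j₂ Y : ℤ) := by
      rw [hJeq, sum_pair hne]
    rw [hJsum, hJ2']
    push_cast
    linarith [hlhs, hind, hU']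

end Summit.PneNP.PneNP.Theorems.ClusCoord
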